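import Summits.Ventures.HodgeRepro2.T5BergmanSchurGeneral

/-!
# The `K`-type expansion of the translated lowest-weight vector and the first column of the
`K`-type matrix, in closed form

`π_k(g) 1 = j(g⁻¹, ·)^{-k} = a^{-k} K_{b/ā}` (`T5BergmanKernel.act_lowest_eq_kernel`, `orbit g = b/ā`),
so its Taylor expansion is the binomial series of the coherent state:

  `(π_k(g) 1)(w) = a^{-k} Σₙ C(n+k-1, n) (b̄/a)ⁿ wⁿ`   (`act_lowest_hasSum`),

and the matrix coefficients against the monomials — the first column of the `K`-type matrix — are

  `⟨π_k(g) 1, zⁿ⟩_k = a^{-k} C(n+k-1, n) (b̄/a)ⁿ ⟨zⁿ, zⁿ⟩_k`   (`matrixCoeff_lowest_monomial`),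

with `|⟨π_k(g) 1, zⁿ⟩_k| = C(n+k-1, n) |orbit g|ⁿ |a|^{-k} ⟨zⁿ,zⁿ⟩_k ≤ C(n+k-1, n) ⟨zⁿ,zⁿ⟩_k · |a(g)|^{-k}`
(`norm_matrixCoeff_lowest_monomial`, `norm_matrixCoeff_lowest_monomial_le`): every coefficient of the
lowest-weight vector against a `K`-type decays like `|a(g)|^{-k} = (cosh t)^{-k}` in the Cartan coordinate.
Parseval along the `K`-types of `π_k(g) 1` recovers `⟨1, 1⟩_k` (`hasSum_norm_matrixCoeff_lowest_monomial`).

Blind lane: Mathlib + the HodgeRepro2 prefix only; no sorry; axioms ⊆ {propext, Classical.choice,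
Quot.sound}.
-/

namespace Summit.Ventures.HodgeRepro2.T5BergmanLowestKTypes

open MeasureTheory Metric Filter Topology
open T5PoincareDensity T5SU11Unimodular T5SU11Fibration
open T5BergmanCoefficient T5BergmanPairing T5BergmanUnitary T5BergmanFourier T5BergmanKernel
  T5BergmanParseval T5BergmanActStable T5BergmanMatrixCoeff T5BergmanSchur T5BergmanSchurGeneral
open scoped Real

/-- **The `K`-type expansion of `π_k(g) 1`**: `(π_k(g) 1)(w) = Σₙ a^{-k} C(n+k-1,n) (b̄/a)ⁿ wⁿ` on the disc
(`kernelCoeff k (orbit g) n = C(n+k-1,n) conj(orbit g)ⁿ`). -/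
theorem act_lowest_hasSum (k : ℕ) (hk : 2 ≤ k) (g : SU11) {w : ℂ} (hw : w ∈ ball (0 : ℂ) 1) :
    HasSum (fun n => ((mat g 0 0)⁻¹ ^ k * kernelCoeff k (orbit g) n) * w ^ n) (act k g lowest w) := by
  rw [act_lowest_eq_kernel k g w]
  have h := (hasSum_kernel k hk (orbit_mem_ball g) hw).mul_left ((mat g 0 0)⁻¹ ^ k)
  refine h.congr_fun fun n => ?_
  ring

/-- **The first column of the `K`-type matrix**:
`⟨π_k(g) 1, zⁿ⟩_k = a^{-k} C(n+k-1,n) (b̄/a)ⁿ ⟨zⁿ, zⁿ⟩_k`. -/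
theorem matrixCoeff_lowest_monomial (k : ℕ) (hk : 2 ≤ k) (g : SU11) (n : ℕ) :
    matrixCoeff k lowest (fun w => w ^ n) g =
      (mat g 0 0)⁻¹ ^ k * kernelCoeff k (orbit g) n * ((monomialNormSq k n : ℝ) : ℂ) := by
  unfold matrixCoeff
  exact pairing_monomial_right k hk _ (act k g lowest) (fun w hw => act_lowest_hasSum k hk g hw)
    (integrableOn_act k hk g lowest (differentiableOn_const 1)
      (by simpa [lowest] using integrableOn_monomial k 0)) n

/-- `|⟨π_k(g) 1, zⁿ⟩_k| = C(n+k-1,n) |orbit g|ⁿ |a|^{-k} ⟨zⁿ,zⁿ⟩_k`. -/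
theorem norm_matrixCoeff_lowest_monomial (k : ℕ) (hk : 2 ≤ k) (g : SU11) (n : ℕ) :
    ‖matrixCoeff k lowest (fun w => w ^ n) g‖ =
      (((n + k - 1).choose n : ℕ) : ℝ) * ‖orbit g‖ ^ n * ‖mat g 0 0‖⁻¹ ^ k * monomialNormSq k n := by
  rw [matrixCoeff_lowest_monomial k hk g n, norm_mul, norm_mul, norm_pow, norm_inv, Complex.norm_real,
    Real.norm_eq_abs, abs_of_pos (monomialNormSq_pos k n)]
  unfold kernelCoeff
  rw [norm_mul, norm_pow, Complex.norm_conj, Complex.norm_natCast]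
  ring

/-- **Decay of the first column**: `|⟨π_k(g) 1, zⁿ⟩_k| ≤ C(n+k-1,n) ⟨zⁿ,zⁿ⟩_k · |a(g)|^{-k}`. -/
theorem norm_matrixCoeff_lowest_monomial_le (k : ℕ) (hk : 2 ≤ k) (g : SU11) (n : ℕ) :
    ‖matrixCoeff k lowest (fun w => w ^ n) g‖ ≤
      (((n + k - 1).choose n : ℕ) : ℝ) * monomialNormSq k n * ‖mat g 0 0‖⁻¹ ^ k := by
  rw [norm_matrixCoeff_lowest_monomial k hk g n]
  have h1 : ‖orbit g‖ ^ n ≤ 1 :=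
    pow_le_one₀ (norm_nonneg _) (mem_ball_zero_iff.mp (orbit_mem_ball g)).le
  have h2 : (0 : ℝ) ≤ (((n + k - 1).choose n : ℕ) : ℝ) := by positivity
  have h3 : (0 : ℝ) ≤ ‖mat g 0 0‖⁻¹ ^ k := by positivity
  have h4 := (monomialNormSq_pos k n).le
  calc (((n + k - 1).choose n : ℕ) : ℝ) * ‖orbit g‖ ^ n * ‖mat g 0 0‖⁻¹ ^ k * monomialNormSq k n
      ≤ (((n + k - 1).choose n : ℕ) : ℝ) * 1 * ‖mat g 0 0‖⁻¹ ^ k * monomialNormSq k n := by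
        gcongr
    _ = (((n + k - 1).choose n : ℕ) : ℝ) * monomialNormSq k n * ‖mat g 0 0‖⁻¹ ^ k := by ring

/-- **Parseval along the `K`-types of `π_k(g) 1`**:
`Σₙ |⟨π_k(g) 1, zⁿ⟩_k|² / ⟨zⁿ,zⁿ⟩_k = ⟨π_k(g) 1, π_k(g) 1⟩_k = ⟨1, 1⟩_k = π/(k-1)`. -/
theorem hasSum_norm_matrixCoeff_lowest_monomial (k : ℕ) (hk : 2 ≤ k) (g : SU11) :
    HasSum (fun n => ‖matrixCoeff k lowest (fun w => w ^ n) g‖ ^ 2 / monomialNormSq k n)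
      (π / ((k : ℝ) - 1)) := by
  have h := hasSum_pairing_self k hk _ (act k g lowest) (fun w hw => act_lowest_hasSum k hk g hw)
    (integrableOn_act k hk g lowest (differentiableOn_const 1)
      (by simpa [lowest] using integrableOn_monomial k 0))
  rw [pairing_act_act k hk g lowest lowest, pairing_lowest_lowest k hk, Complex.ofReal_re] at h
  refine h.congr_fun fun n => ?_
  rw [matrixCoeff_lowest_monomial k hk g n, norm_mul, Complex.norm_real, Real.norm_eq_abs,
    abs_of_pos (monomialNormSq_pos k n), mul_pow]
  have hm := (monomialNormSq_pos k n).ne'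
  field_simp

end Summit.Ventures.HodgeRepro2.T5BergmanLowestKTypes
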